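import Literature.Topology.FourManifolds.HCobordismAuxiliaryPairProofs

/-!
# A map of the circle is null-homotopic when its loop is

Topic `Literature/Topology/FourManifolds` (infrastructure for the fact seat
`provefact-Literature.Geometry.Riemannian.LawsonMichelsohn1984_surrounding`: in Wall's form of the
trading of `1`-handles the two circles `S₁`, `S₂` of Milnor's proof of Thm. 8.1 Index 1 are
shown homotopic in `V₂₊` through null-homotopies of their *loops*, obtained from the
injectivity of `π₁(V₂₊) → π₁(W)` (`LevelLoopsInjective.lean`), instead of from `π₁(V₂₊) = 1`).
Everything here is **proved**.

`HCobordismAuxiliaryPairProofs.lean` (§ CircleMaps) proves that a map of the circle into a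
simply connected space is homotopic to a constant, by descending a null-homotopy of the loop
`t ↦ e (cos 2πt, sin 2πt)` rel end-points along the quotient map `[0, 1] × [0, 1] → [0, 1] × S¹`.
The same descent with the null-homotopy of the loop as a *hypothesis*:

* `ContinuousMap.circleLoop e` — the loop `t ↦ e (cos 2πt, sin 2πt)` of `e : C(S¹, Y)` at
  `e (1, 0)` (a `def`-free abbreviation is not possible for a `Path`, so this is a definition);
* `ContinuousMap.homotopic_const_of_circleLoop_homotopic_refl` — if `circleLoop e` is
  homotopic rel end-points to the constant loop then `e` is homotopic to the constant map;
* `ContinuousMap.homotopic_of_circleLoop_homotopic_refl` — two maps of the circle into a path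
  connected space whose loops are both null-homotopic are homotopic.

## References

* A. Hatcher, *Algebraic Topology* (2002), §1.1 (loops and maps of `S¹`) and §4.1 (change of
  base point). [HatcherAT2002]
-/

open scoped unitInterval
open Set Function

noncomputable section

namespace Literature.Topology.FourManifolds

section CircleMaps

variable {Y : Type*} [TopologicalSpace Y]

/-- The standard parametrisation `t ↦ (cos 2πt, sin 2πt)` of the unit circle by `[0, 1]`.
[folklore] -/
def circleParam : C(unitInterval, Metric.sphere (0 : EuclideanSpace ℝ (Fin 2)) 1) :=
  ⟨fun t => circlePoint (2 * Real.pi * t), continuous_circlePoint.comp (by fun_prop)⟩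

/-- `circleParam t = (cos 2πt, sin 2πt)`. [folklore] -/
theorem circleParam_apply (t : unitInterval) : circleParam t = circlePoint (2 * Real.pi * t) := rfl

/-- `circleParam 0 = (1, 0)`. [folklore] -/
theorem circleParam_zero : circleParam 0 = circlePoint 0 := by simp [circleParam_apply]

/-- `circleParam 1 = (1, 0)`. [folklore] -/
theorem circleParam_one : circleParam 1 = circlePoint 0 := by
  rw [circleParam_apply, Set.Icc.coe_one, mul_one, ← zero_add (2 * Real.pi), circlePoint_add_two_pi]

/-- `circleParam` is onto. [folklore] -/
theorem circleParam_surjective : Surjective circleParam := fun u =>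
  exists_circlePoint_two_pi_mul_eq u

/-- **The loop of a map of the circle**: `t ↦ e (cos 2πt, sin 2πt)`, a loop at `e (1, 0)`.
[folklore] -/
def _root_.ContinuousMap.circleLoop (e : C(Metric.sphere (0 : EuclideanSpace ℝ (Fin 2)) 1, Y)) :
    Path (e (circlePoint 0)) (e (circlePoint 0)) where
  toFun t := e (circleParam t)
  continuous_toFun := e.continuous.comp circleParam.continuous
  source' := by rw [circleParam_zero]
  target' := by rw [circleParam_one]

/-- `circleLoop e t = e (cos 2πt, sin 2πt)`. [folklore] -/
theorem _root_.ContinuousMap.circleLoop_apply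
    (e : C(Metric.sphere (0 : EuclideanSpace ℝ (Fin 2)) 1, Y)) (t : unitInterval) :
    e.circleLoop t = e (circleParam t) := rfl

/-- The loop of `g ∘ e` is the image of the loop of `e`. [folklore] -/
theorem _root_.ContinuousMap.circleLoop_comp {Z : Type*} [TopologicalSpace Z]
    (e : C(Metric.sphere (0 : EuclideanSpace ℝ (Fin 2)) 1, Y)) (g : C(Y, Z)) :
    (g.comp e).circleLoop = e.circleLoop.map g.continuous := by
  ext t; rfl

/-- **A map of the circle whose loop is null-homotopic rel end-points is homotopic to a
constant map**: the null-homotopy of the loop descends along the quotient map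
`[0, 1] × [0, 1] → [0, 1] × S¹` (the proof of
`ContinuousMap.homotopic_const_of_simplyConnectedSpace`, with the null-homotopy as a
hypothesis). [folklore] -/
theorem _root_.ContinuousMap.homotopic_const_of_circleLoop_homotopic_refl
    (e : C(Metric.sphere (0 : EuclideanSpace ℝ (Fin 2)) 1, Y))
    (h : e.circleLoop.Homotopic (Path.refl _)) :
    e.Homotopic (ContinuousMap.const (Metric.sphere (0 : EuclideanSpace ℝ (Fin 2)) 1)
      (e (circlePoint 0))) := by
  obtain ⟨H⟩ := h
  -- the quotient map `Q (s, t) = (s, q t)`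
  set Q : C(unitInterval × unitInterval,
      unitInterval × Metric.sphere (0 : EuclideanSpace ℝ (Fin 2)) 1) :=
    ⟨fun p => (p.1, circleParam p.2), continuous_fst.prodMk (circleParam.continuous.comp
      continuous_snd)⟩ with hQ
  have hQs : Surjective Q := fun p => by
    obtain ⟨t, ht⟩ := circleParam_surjective p.2
    exact ⟨(p.1, t), Prod.ext rfl ht⟩
  have hQq : Topology.IsQuotientMap Q :=
    Topology.IsQuotientMap.of_surjective_continuous hQs Q.continuous
  -- `H` is constant on the fibres of `Q`
  have hfac : Function.FactorsThrough H.toContinuousMap Q := by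
    rintro ⟨s, t⟩ ⟨s', t'⟩ hst
    obtain ⟨hss', htt'⟩ := Prod.mk.inj hst
    subst hss'
    show H (s, t) = H (s, t')
    rcases eq_or_eq_of_circlePoint_two_pi_mul_eq htt' with rfl | ⟨rfl, rfl⟩ | ⟨rfl, rfl⟩
    · rfl
    · rw [H.source, H.target]
    · rw [H.source, H.target]
  set G : C(unitInterval × Metric.sphere (0 : EuclideanSpace ℝ (Fin 2)) 1, Y) :=
    hQq.lift H.toContinuousMap hfac with hG
  have hGQ : ∀ s t, G (s, circleParam t) = H (s, t) := fun s t =>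
    congrFun (congrArg DFunLike.coe (hQq.lift_comp H.toContinuousMap hfac)) (s, t)
  refine ⟨{ toContinuousMap := G, map_zero_left := fun u => ?_, map_one_left := fun u => ?_ }⟩
  · obtain ⟨t, rfl⟩ := circleParam_surjective u
    show G (0, circleParam t) = e (circleParam t)
    rw [hGQ]
    exact H.apply_zero t
  · obtain ⟨t, rfl⟩ := circleParam_surjective u
    show G (1, circleParam t) = e (circlePoint 0)
    rw [hGQ]
    exact H.apply_one t

/-- **Two maps of the circle into a path connected space whose loops are null-homotopic are
homotopic.** [folklore] -/
theorem _root_.ContinuousMap.homotopic_of_circleLoop_homotopic_refl [PathConnectedSpace Y]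
    (e₁ e₂ : C(Metric.sphere (0 : EuclideanSpace ℝ (Fin 2)) 1, Y))
    (h₁ : e₁.circleLoop.Homotopic (Path.refl _)) (h₂ : e₂.circleLoop.Homotopic (Path.refl _)) :
    e₁.Homotopic e₂ := by
  haveI : Nonempty (Metric.sphere (0 : EuclideanSpace ℝ (Fin 2)) 1) := ⟨circlePoint 0⟩
  exact (ContinuousMap.homotopic_const_of_circleLoop_homotopic_refl e₁ h₁).trans
    ((ContinuousMap.homotopic_const_iff.2 (PathConnectedSpace.joined _ _)).trans
      (ContinuousMap.homotopic_const_of_circleLoop_homotopic_refl e₂ h₂).symm)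

end CircleMaps

end Literature.Topology.FourManifolds

end
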